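import Summits.QuantumFields.YangMills.Theorems.FluctuationComparisonRegPrIntLOrganTangentFibreMeanVersionKnit
import Summits.QuantumFields.YangMills.Theorems.BalabanUVNodesN09DomAltThresholdNull
import Literature.MathematicalPhysics.QuantumFieldTheory.Balaban1983to89.T3UnitScaleTilt
import Literature.MathematicalPhysics.QuantumFieldTheory.Balaban1983to89.T3UnitLawDensityEML
import Literature.MathematicalPhysics.QuantumFieldTheory.Balaban1983to89.T3OrbitAverage
import HarnessLib

/-!
# Crux `FluctuationComparisonRegPrIntL` (stmt-QuantumFields-20520, rung R3), PATH-B organ O1, LINE g26-2 «jensen_cumulant» (ideator ym-r3-idea-1 g26) —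
# THE WINDOW-CONTINUOUS VERSION OF THE LOCALISED FIBRE SECOND MOMENT `v` (repair R-VAR): VER∘'s knit with `h ↦ h²`

LEAD-20520 width seat ym-ust-20520-w3 g23 (cell ym3-torus), `--supports stmt-QuantumFields-20520` (helper).  THEOREMS ONLY, def-free, generic cut `cW`.

WHY.  LINE g26-2 v1 (`Lines/jensen_cumulant.lean` 83b6f839) cuts JEN∘ as `g = q + (g − q)`, `q = ½(v − m²)`, and reads the fibre second moment
`v V := (∫ χ·h²·ρ′ dσ_V)∕(∫ χ·ρ′ dσ_V)` POINTWISE from an ARBITRARY disintegration `σ` — the D25-4 corner (a null-set modification of `σ` moves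
`v` at a point by the fibre oscillation of `h²`; LEAD typing note L-g26-2).  The repair R-VAR asks for the CONTINUOUS version of `v` with an a.e.
identity, exactly as VER∘ does for `m`; this file shows that such a version EXISTS (and is `(∫ χ h² ρ′ dλ_V)∕(∫ χ ρ′ dλ_V)`) from the same
(A)-package that pays VER∘ — so R-VAR is not a new bet.  Statement and proof = ✓`…OrganTangentFibreMeanVersionKnitAnyCut` (p784192) `…_ac` with the
integrand squared; nothing else changes.

HONEST FRAMING: a knit over hypothesis letters; nothing of Bałaban's analysis is asserted or proved; (A), VAR∘, LME3∘, JEN∘, VER∘ (rows), O1, crux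
20520, `YM3TorusSU2` are NOT proved; registry `Lines/semiclassical_s2beta.lean` v11.4 (★★OWNER RULING №36) untouched; rung R3 = SU(2) YM₃ on T³ — NOT
d = 4, NOT infinite volume, NOT a mass gap, NOT Clay; the Yang–Mills mass gap is NOT proved by any of this.
-/

set_option autoImplicit false

noncomputable section

namespace Summit.QuantumFields.YangMills.Theorems.OrganTangentSecondMomentVersion

open MeasureTheory ProbabilityTheory Filter Topology Set
open scoped ENNReal
open Literature.MathematicalPhysics.QuantumFieldTheory.Balaban1983to89
open T3ContinuumYM3Torus T3NestedUnitLaws T3UnitLawDensityEML T3UnitScaleTilt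
open Literature.MathematicalPhysics.QuantumFieldTheory.Balaban1983to89.T3OrbitAverage
open Summit.QuantumFields.YangMills.Theorems.OrganTangentFibreMeanTools
open Summit.QuantumFields.YangMills.BalabanUVNodes.N09DomAltThresholdNull (isOpen_setOf_plaqSmall_SU)

/-- ★ **A WINDOW-CONTINUOUS VERSION OF THE LOCALISED FIBRE SECOND MOMENT** (the `v` of LINE g26-2 «jensen_cumulant», repair R-VAR of the LEAD
typing note 2026-08-30): EXACTLY ✓`…FibreMeanVersionKnitAnyCut.fibreMeanVersion_of_regularSmallFieldDisintegration_ac` with the integrand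
`χ·(log r − log r′)·r′` replaced by `χ·(log r − log r′)²·r′` — in O1's frame at heights `j, j+1` (smooth-cut `≪`-form transfer `mY`), for a
continuous cutoff `χ` supported in and positive on the `cW`-window and the (A)-package `(σ₀, λ; (A1)(A2)(A3))`: for EVERY disintegration `σ` of
`dU_{j+1}` along `descend` there is a `window_j`-CONTINUOUS `v` with `χ·h²·r′` `σ_V`-integrable and `v V = (∫ χ h² r′ dσ_V)∕(∫ χ r′ dσ_V)` for
`dU_j`-a.e. window `V`.  Same proof (the version is `(∫ χ h² r′ dλ_V)∕(∫ χ r′ dλ_V)`; uniqueness of disintegrations, (A3), transfer).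
[cite: Balaban1985Averaging, (10)-(13) p.19; Balaban1987RG1, (0.13) p.254] -/
theorem fibreSecondMomentVersion_of_regularSmallFieldDisintegration_ac
    (F : T3Family) (γ b₀ p₀ : ℝ) (j : ℕ) (hθ : 0 < θBal F.L γ b₀ p₀ (j + 1)) (cW : ℝ) (hcW : cW < 1)
    (r r' : GaugeField (F.P (j + 1)) 0 ↥(Matrix.specialUnitaryGroup (Fin 2) ℂ) → ℝ)
    (rj : GaugeField (F.P j) 0 ↥(Matrix.specialUnitaryGroup (Fin 2) ℂ) → ℝ)
    (hpos : ∀ U, PlaqSmall (θBal F.L γ b₀ p₀ (j + 1)) U → 0 < r U ∧ 0 < r' U)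
    (hr : ContinuousOn r {U | PlaqSmall (θBal F.L γ b₀ p₀ (j + 1)) U})
    (hr' : ContinuousOn r' {U | PlaqSmall (θBal F.L γ b₀ p₀ (j + 1)) U})
    (hrj : Measurable rj) (hrjpos : ∀ V, PlaqSmall (θBal F.L γ b₀ p₀ j) V → 0 < rj V)
    (mY : Measure (GaugeField (F.P (j + 1)) 0 ↥(Matrix.specialUnitaryGroup (Fin 2) ℂ)))
    (hmY : mY ≪ fieldMeasure (F.P (j + 1)) 0 ↥(Matrix.specialUnitaryGroup (Fin 2) ℂ))
    (hcons : mY.map (descend F ℰp j) =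
      (fieldMeasure (F.P j) 0 ↥(Matrix.specialUnitaryGroup (Fin 2) ℂ)).withDensity (fun V => ENNReal.ofReal (rj V)))
    (σ : Kernel (GaugeField (F.P j) 0 ↥(Matrix.specialUnitaryGroup (Fin 2) ℂ))
      (GaugeField (F.P (j + 1)) 0 ↥(Matrix.specialUnitaryGroup (Fin 2) ℂ)))
    (hσM : IsMarkovKernel σ)
    (hbind : (Measure.map (descend F ℰp j) (fieldMeasure (F.P (j + 1)) 0 ↥(Matrix.specialUnitaryGroup (Fin 2) ℂ))).bind ⇑σ =
      fieldMeasure (F.P (j + 1)) 0 ↥(Matrix.specialUnitaryGroup (Fin 2) ℂ))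
    (hfib : ∀ᵐ V ∂(Measure.map (descend F ℰp j) (fieldMeasure (F.P (j + 1)) 0 ↥(Matrix.specialUnitaryGroup (Fin 2) ℂ))),
      ∀ᵐ U ∂(σ V), descend F ℰp j U = V)
    (χ : GaugeField (F.P (j + 1)) 0 ↥(Matrix.specialUnitaryGroup (Fin 2) ℂ) → ℝ) (hχc : Continuous χ) (hχ0 : ∀ U, 0 ≤ χ U)
    (hχsupp : ∀ U, χ U ≠ 0 → PlaqSmall (cW * θBal F.L γ b₀ p₀ (j + 1)) U)
    (hχpos : ∀ U, PlaqSmall (cW * θBal F.L γ b₀ p₀ (j + 1)) U → 0 < χ U)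
    (σ₀ : Kernel (GaugeField (F.P j) 0 ↥(Matrix.specialUnitaryGroup (Fin 2) ℂ))
      (GaugeField (F.P (j + 1)) 0 ↥(Matrix.specialUnitaryGroup (Fin 2) ℂ)))
    (hσ₀M : IsMarkovKernel σ₀)
    (hbind₀ : (Measure.map (descend F ℰp j) (fieldMeasure (F.P (j + 1)) 0 ↥(Matrix.specialUnitaryGroup (Fin 2) ℂ))).bind ⇑σ₀ =
      fieldMeasure (F.P (j + 1)) 0 ↥(Matrix.specialUnitaryGroup (Fin 2) ℂ))
    (hfib₀ : ∀ᵐ V ∂(Measure.map (descend F ℰp j) (fieldMeasure (F.P (j + 1)) 0 ↥(Matrix.specialUnitaryGroup (Fin 2) ℂ))),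
      ∀ᵐ U ∂(σ₀ V), descend F ℰp j U = V)
    (lam : GaugeField (F.P j) 0 ↥(Matrix.specialUnitaryGroup (Fin 2) ℂ) →
      Measure (GaugeField (F.P (j + 1)) 0 ↥(Matrix.specialUnitaryGroup (Fin 2) ℂ)))
    (hlam : ∀ V, IsFiniteMeasure (lam V))
    (hA1 : ∀ f : GaugeField (F.P (j + 1)) 0 ↥(Matrix.specialUnitaryGroup (Fin 2) ℂ) → ℝ, Continuous f →
      (∀ U, f U ≠ 0 → PlaqSmall (cW * θBal F.L γ b₀ p₀ (j + 1)) U) →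
      ContinuousOn (fun V => ∫ U, f U ∂(lam V)) {V | PlaqSmall (θBal F.L γ b₀ p₀ j) V})
    (hA2 : ∀ V, PlaqSmall (θBal F.L γ b₀ p₀ j) V → 0 < lam V {U | PlaqSmall (cW * θBal F.L γ b₀ p₀ (j + 1)) U})
    (hA3 : ∃ c : GaugeField (F.P j) 0 ↥(Matrix.specialUnitaryGroup (Fin 2) ℂ) → ℝ,
      ∀ f : GaugeField (F.P (j + 1)) 0 ↥(Matrix.specialUnitaryGroup (Fin 2) ℂ) → ℝ, Continuous f →
        (∀ U, ¬ PlaqSmall (cW * θBal F.L γ b₀ p₀ (j + 1)) U → f U = 0) →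
        ∀ᵐ V ∂(Measure.map (descend F ℰp j) (fieldMeasure (F.P (j + 1)) 0 ↥(Matrix.specialUnitaryGroup (Fin 2) ℂ))),
          PlaqSmall (θBal F.L γ b₀ p₀ j) V → 0 < c V ∧ ∫ U, f U ∂(σ₀ V) = c V * ∫ U, f U ∂(lam V)) :
    ∃ v : GaugeField (F.P j) 0 ↥(Matrix.specialUnitaryGroup (Fin 2) ℂ) → ℝ,
      ContinuousOn v {V | PlaqSmall (θBal F.L γ b₀ p₀ j) V} ∧
      (∀ᵐ V ∂(fieldMeasure (F.P j) 0 ↥(Matrix.specialUnitaryGroup (Fin 2) ℂ)), PlaqSmall (θBal F.L γ b₀ p₀ j) V →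
        Integrable (fun U => χ U * (Real.log (r U) - Real.log (r' U)) ^ 2 * r' U) (σ V) ∧
        v V = (∫ U, χ U * (Real.log (r U) - Real.log (r' U)) ^ 2 * r' U ∂(σ V)) / (∫ U, χ U * r' U ∂(σ V))) := by
  haveI := hσM
  haveI := hσ₀M
  haveI : BorelSpace (GaugeField (F.P (j + 1)) 0 ↥(Matrix.specialUnitaryGroup (Fin 2) ℂ)) :=
    T3OrbitAverage.instBorelSpaceGaugeField
  -- abbreviations
  set θ' : ℝ := θBal F.L γ b₀ p₀ (j + 1) with hθ'
  set θj : ℝ := θBal F.L γ b₀ p₀ j with hθj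
  set Hf : Measure (GaugeField (F.P (j + 1)) 0 ↥(Matrix.specialUnitaryGroup (Fin 2) ℂ)) :=
    fieldMeasure (F.P (j + 1)) 0 ↥(Matrix.specialUnitaryGroup (Fin 2) ℂ) with hHf
  set Hc : Measure (GaugeField (F.P j) 0 ↥(Matrix.specialUnitaryGroup (Fin 2) ℂ)) :=
    fieldMeasure (F.P j) 0 ↥(Matrix.specialUnitaryGroup (Fin 2) ℂ) with hHc
  haveI : IsProbabilityMeasure Hf := Missing.isProbabilityMeasure_fieldMeasure _ _
  haveI : Nonempty (GaugeField (F.P (j + 1)) 0 ↥(Matrix.specialUnitaryGroup (Fin 2) ℂ)) := ⟨fun _ => 1⟩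
  have hd : Measurable (descend F ℰp j :
      GaugeField (F.P (j + 1)) 0 ↥(Matrix.specialUnitaryGroup (Fin 2) ℂ) →
        GaugeField (F.P j) 0 ↥(Matrix.specialUnitaryGroup (Fin 2) ℂ)) :=
    T3NestedUnitLaws.measurable_descend F ℰp measurableE_ℰp j
  -- the windows
  set O : Set (GaugeField (F.P (j + 1)) 0 ↥(Matrix.specialUnitaryGroup (Fin 2) ℂ)) := {U | PlaqSmall θ' U} with hO
  set O₃ : Set (GaugeField (F.P (j + 1)) 0 ↥(Matrix.specialUnitaryGroup (Fin 2) ℂ)) := {U | PlaqSmall (cW * θ') U} with hO₃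
  set W : Set (GaugeField (F.P j) 0 ↥(Matrix.specialUnitaryGroup (Fin 2) ℂ)) := {V | PlaqSmall θj V} with hW
  have hOopen : IsOpen O := isOpen_setOf_plaqSmall_SU 2 (F.P (j + 1)) 0 θ'
  have hχts : tsupport χ ⊆ O := tsupport_subset_plaqSmall (mul_lt_of_lt_one_left hθ hcW) hχsupp
  have hO₃O : O₃ ⊆ O := fun U hU p => (hU p).trans (mul_lt_of_lt_one_left hθ hcW)
  -- the two localised integrands, globally continuous
  set g : GaugeField (F.P (j + 1)) 0 ↥(Matrix.specialUnitaryGroup (Fin 2) ℂ) → ℝ :=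
    fun U => (Real.log (r U) - Real.log (r' U)) ^ 2 * r' U with hg
  have hgc : ContinuousOn g O :=
    (((hr.log fun U hU => (hpos U hU).1.ne').sub (hr'.log fun U hU => (hpos U hU).2.ne')).pow 2).mul hr'
  set f₁ : GaugeField (F.P (j + 1)) 0 ↥(Matrix.specialUnitaryGroup (Fin 2) ℂ) → ℝ := fun U => χ U * g U with hf₁
  set f₂ : GaugeField (F.P (j + 1)) 0 ↥(Matrix.specialUnitaryGroup (Fin 2) ℂ) → ℝ := fun U => χ U * r' U with hf₂
  have hf₁c : Continuous f₁ := continuous_mul_of_tsupport_subset hOopen hχc hχts hgc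
  have hf₂c : Continuous f₂ := continuous_mul_of_tsupport_subset hOopen hχc hχts hr'
  have hf₁eq : (fun U => χ U * (Real.log (r U) - Real.log (r' U)) ^ 2 * r' U) = f₁ := by
    funext U; simp only [hf₁, hg]; ring
  have hf₁supp : ∀ U, f₁ U ≠ 0 → PlaqSmall (cW * θ') U := fun U hU => hχsupp U (left_ne_zero_of_mul hU)
  have hf₂supp : ∀ U, f₂ U ≠ 0 → PlaqSmall (cW * θ') U := fun U hU => hχsupp U (left_ne_zero_of_mul hU)
  have hf₁zero : ∀ U, U ∉ O₃ → f₁ U = 0 := fun U hU => by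
    by_contra h; exact hU (hf₁supp U h)
  have hf₂zero : ∀ U, U ∉ O₃ → f₂ U = 0 := fun U hU => by
    by_contra h; exact hU (hf₂supp U h)
  have hf₂nn : ∀ U, 0 ≤ f₂ U := by
    intro U
    by_cases hU : χ U = 0
    · simp only [hf₂, hU, zero_mul, le_refl]
    · exact mul_nonneg (hχ0 U) (hpos U (hO₃O (hχsupp U hU))).2.le
  have hf₂O₃ : ∀ U, U ∈ O₃ → f₂ U ≠ 0 := fun U hU =>
    mul_ne_zero (hχpos U hU).ne' (hpos U (hO₃O hU)).2.ne'
  -- the version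
  set num : GaugeField (F.P j) 0 ↥(Matrix.specialUnitaryGroup (Fin 2) ℂ) → ℝ := fun V => ∫ U, f₁ U ∂(lam V) with hnum
  set den : GaugeField (F.P j) 0 ↥(Matrix.specialUnitaryGroup (Fin 2) ℂ) → ℝ := fun V => ∫ U, f₂ U ∂(lam V) with hden
  have hnumc : ContinuousOn num W := hA1 f₁ hf₁c hf₁supp
  have hdenc : ContinuousOn den W := hA1 f₂ hf₂c hf₂supp
  have hdenpos : ∀ V, V ∈ W → 0 < den V := by
    intro V hV
    haveI := hlam V
    have hint : Integrable f₂ (lam V) := integrable_of_continuous_compact hf₂c (lam V)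
    rw [hden]
    refine (integral_pos_iff_support_of_nonneg_ae (Eventually.of_forall hf₂nn) hint).mpr ?_
    exact (hA2 V hV).trans_le (measure_mono fun U hU => Function.mem_support.mpr (hf₂O₃ U hU))
  refine ⟨fun V => num V / den V, hnumc.div hdenc fun V hV => (hdenpos V hV).ne', ?_⟩
  -- uniqueness of the disintegration: σ = σ₀ a.e.
  have huniq : ∀ᵐ V ∂(Hf.map (descend F ℰp j)), σ V = σ₀ V :=
    ae_eq_of_bind_of_bind Hf hd σ σ₀ hbind hfib hbind₀ hfib₀
  -- the identity, `descend_* dU_{j+1}`-a.e. on the window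
  have hkey : ∀ᵐ V ∂(Hf.map (descend F ℰp j)), V ∈ W →
      (Integrable (fun U => χ U * (Real.log (r U) - Real.log (r' U)) ^ 2 * r' U) (σ V) ∧
        num V / den V = (∫ U, χ U * (Real.log (r U) - Real.log (r' U)) ^ 2 * r' U ∂(σ V)) / (∫ U, χ U * r' U ∂(σ V))) := by
    obtain ⟨c, hc⟩ := hA3
    filter_upwards [huniq, hc f₁ hf₁c hf₁zero, hc f₂ hf₂c hf₂zero] with V hVσ hV1 hV2
    intro hVW
    refine ⟨?_, ?_⟩
    · rw [hf₁eq]; exact integrable_of_continuous_compact hf₁c (σ V)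
    obtain ⟨hc0, hres1⟩ := hV1 hVW
    obtain ⟨-, hres2⟩ := hV2 hVW
    rw [hf₁eq, show (fun U => χ U * r' U) = f₂ from rfl, hVσ, hres1, hres2, mul_div_mul_left _ _ hc0.ne']
  -- transfer `descend_* dU_{j+1}`-a.e. ⇒ `dU_j`-a.e. on the window through the (≪-form) consistency identity
  have hWne : ∀ V ∈ W, ENNReal.ofReal (rj V) ≠ 0 := fun V hV => (ENNReal.ofReal_pos.mpr (hrjpos V hV)).ne'
  have hρX : AEMeasurable (fun V => ENNReal.ofReal (rj V)) Hc := (ENNReal.measurable_ofReal.comp hrj).aemeasurable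
  have := OrganTangentFibreMeanVersionKnit.ae_on_of_ae_map_of_ac_of_map_eq Hf hd Hc mY hmY hρX hcons hWne hkey
  filter_upwards [this] with V hV hVW
  exact hV hVW hVW

end Summit.QuantumFields.YangMills.Theorems.OrganTangentSecondMomentVersion

end
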